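import Literature.NumberTheory.QuadraticForms.HilbertReciprocityRat
import Literature.NumberTheory.EllipticCurves.TwoDescentLocalI0
import Literature.NumberTheory.EllipticCurves.KramerTwoDescentSquares
import HarnessLib

/-!
# D0≤2, parity of the genus twist, I: Serre's local signs in bits and Hilbert reciprocity for the descent form

Crux R″ `RankOneTwoTorsionResidualAtTwo` (stmt-27478), LINE 49 «full_vertex», stub D0≤2
`FullTorsionGenusSelmerLawUpToTwoAtTwo`, slice `#Q₀ = 2`, the `2`-PARITY HALF of `#Sel⁽²⁾(E₀^{(−p₀q₁q₂)}) = 8`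
made UNCONDITIONAL (Klagsbrun–Mazur–Rubin's relative parity, explicit for split `2`-torsion over `ℚ`).

For a curve `E/ℚ` with rational `2`-torsion `e₁, e₂, e₃` the Hilbert-symbol Tate quadratic form at a place `v` is
`Q_v(a, b) = (a, b)_v (a, D₂)_v (b, D₁)_v`, `D₁ = (e₁−e₂)(e₁−e₃)`, `D₂ = (e₂−e₁)(e₂−e₃)`
(`Literature/…/TwoDescentHilbertQuadraticForm.lean`). This file is the elementary bookkeeping over `ℚ`:

* §1 **signs as bits**: Serre's explicit local signs `localSignOdd ℓ A B` (at a prime `ℓ ≡ 3 (mod 4)`) and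
  `localSignInfty A B` as `(−1)^{bit}` with `bit` a polynomial in the tree's `parityBit`, `qrBit`, `signBit`
  (`localSignOdd_eq_neg_one_pow_bits`, `localSignInfty_eq_neg_one_pow_signBit`); signs with even valuations are `1`.
* §2 **reciprocity for the form**: `∏_v Q_v(A, B) = 1` over `∞` and the primes dividing `2 A B D₁ D₂`
  (`prod_localSign_descentForm_eq_one`, three instances of the tree's `totalSign_eq_one` = Hilbert reciprocity over `ℚ`).

Everything is proved; no LINE 49 statement is restated; BSD is not advanced by this file alone.

## References

* [KlagsbrunMazurRubin2013] Z. Klagsbrun, B. Mazur, K. Rubin, Ann. of Math. 178 (2013), Def. 3.3, Thm. 3.9.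
* [Serre1973] J.-P. Serre, *A Course in Arithmetic*, Ch. III §1.2 Thm. 1, §2.1 Thm. 3.
-/

noncomputable section

open scoped Classical

namespace Summit.BirchSwinnertonDyer.BirchSwinnertonDyer.Theorems.GenusKolyvaginAtTwo.TorsionCellD0

open WeierstrassCurve WeierstrassCurve.Affine WeierstrassCurve.Affine.Point
open Literature.NumberTheory.GaloisRepresentations Literature.NumberTheory.EllipticCurves Field
open Literature.NumberTheory.EllipticCurves.TwoDescentLocal
open Literature.NumberTheory.EllipticCurves.KramerTwoDescent
open Literature.NumberTheory.QuadraticForms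
open IsDedekindDomain NumberField Rat.HeightOneSpectrum

/-! ## §0 `(−1)^{bit}` -/

section Bits

/-- `(−1)^{x+y} = (−1)^x (−1)^y` for bits `x, y ∈ ℤ/2` (read through `ZMod.val`). [folklore] -/
theorem neg_one_pow_val_add (x y : ZMod 2) :
    ((-1 : ℤ) ^ (x + y).val) = (-1) ^ x.val * (-1) ^ y.val := by
  revert x y; decide

/-- `(−1)^x = 1 ↔ x = 0` for a bit `x ∈ ℤ/2`. [folklore] -/
theorem neg_one_pow_val_eq_one_iff (x : ZMod 2) : ((-1 : ℤ) ^ x.val) = 1 ↔ x = 0 := by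
  revert x; decide

/-- `(−1)^x = −1 ↔ x = 1` for a bit `x ∈ ℤ/2`. [folklore] -/
theorem neg_one_pow_val_eq_neg_one_iff (x : ZMod 2) : ((-1 : ℤ) ^ x.val) = -1 ↔ x = 1 := by
  revert x; decide

/-- A `±1`-valued integer is `(−1)^{bit}` for the bit `[s = −1]`. [folklore] -/
theorem sign_eq_neg_one_pow (s : ℤ) (hs : s = 1 ∨ s = -1) :
    s = (-1) ^ (if s = -1 then (1 : ZMod 2) else 0).val := by
  rcases hs with rfl | rfl <;> decide

end Bits

/-! ## §1 Serre's local signs in bits -/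

section Signs

variable {ℓ : ℕ} [hℓ : Fact ℓ.Prime]

omit hℓ in
/-- The bits of an integer: `parityBit ℓ A = v_ℓ(A) mod 2` and `qrBit ℓ A = [(u_A/ℓ) = −1]`, `u_A` the prime-to-`ℓ` part.
[cite: Serre1973, Ch. III §1.2 Thm. 1] -/
theorem parityBit_intCast_eq (A : ℤ) : parityBit ℓ (A : ℚ) = ((padicValInt ℓ A : ℕ) : ZMod 2) := by
  rw [parityBit, padicValRat.of_int, Int.cast_natCast]

/-- `qrBit ℓ A` is the Legendre bit of the prime-to-`ℓ` part of `A ≠ 0`. [cite: Serre1973, Ch. III §1.2 Thm. 1] -/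
theorem qrBit_intCast_eq {A : ℤ} (hA : A ≠ 0) :
    qrBit ℓ (A : ℚ) = if legendreSym ℓ (primeCompl ℓ A) = -1 then 1 else 0 := by
  have hu := not_dvd_primeCompl (p := ℓ) hA
  have hdec : (A : ℚ) = (ℓ : ℚ) ^ (padicValInt ℓ A) * (primeCompl ℓ A : ℚ) := by
    have := pow_padicValInt_mul_primeCompl ℓ A
    exact_mod_cast this.symm
  have hℓ0 : (ℓ : ℚ) ≠ 0 := by exact_mod_cast hℓ.out.ne_zero
  have hu0 : (primeCompl ℓ A : ℚ) ≠ 0 := by exact_mod_cast primeCompl_ne_zero (p := ℓ) hA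
  rw [hdec, qrBit_mul ℓ (pow_ne_zero _ hℓ0) hu0, ← qrBit_intCast (p := ℓ) hu]
  -- `qrBit ℓ (ℓ^n) = 0`
  suffices h : ∀ n : ℕ, qrBit ℓ ((ℓ : ℚ) ^ n) = 0 by rw [h, zero_add]
  intro n
  induction n with
  | zero => rw [pow_zero, show (1 : ℚ) = 1 * 1 by norm_num, qrBit_mul_self]
  | succ k ih =>
    rw [pow_succ, qrBit_mul ℓ (pow_ne_zero _ hℓ0) hℓ0, ih, zero_add, qrBit_eq_zero_iff,
      res, unitPart, padicValRat.self hℓ.out.one_lt, zpow_one, div_self hℓ0]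
    exact ⟨1, by simp⟩

/-- **Serre's sign at a prime `ℓ ≡ 3 (mod 4)` in bits**: for non-zero integers `A = ℓ^α u`, `B = ℓ^β w`,
`(A, B)_ℓ = (−1)^{αβ} (u/ℓ)^β (w/ℓ)^α = (−1)^{αβ + β·qr(A) + α·qr(B)}` (bits in `ℤ/2`).
[cite: Serre1973, Ch. III §1.2 Thm. 1] -/
theorem localSignOdd_eq_neg_one_pow_bits (hℓ4 : ℓ % 4 = 3) {A B : ℤ} (hA : A ≠ 0) (hB : B ≠ 0) :
    localSignOdd ℓ A B = (-1) ^ (parityBit ℓ (A : ℚ) * parityBit ℓ (B : ℚ) + parityBit ℓ (B : ℚ) * qrBit ℓ (A : ℚ) +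
      parityBit ℓ (A : ℚ) * qrBit ℓ (B : ℚ)).val := by
  rw [localSignOdd_def, ZMod.χ₄_nat_three_mod_four hℓ4, parityBit_intCast_eq, parityBit_intCast_eq,
    qrBit_intCast_eq hA, qrBit_intCast_eq hB]
  have hsA : legendreSym ℓ (primeCompl ℓ A) = 1 ∨ legendreSym ℓ (primeCompl ℓ A) = -1 :=
    legendreSym.eq_one_or_neg_one ℓ (by
      rw [Ne, ZMod.intCast_zmod_eq_zero_iff_dvd]; exact not_dvd_primeCompl (p := ℓ) hA)
  have hsB : legendreSym ℓ (primeCompl ℓ B) = 1 ∨ legendreSym ℓ (primeCompl ℓ B) = -1 :=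
    legendreSym.eq_one_or_neg_one ℓ (by
      rw [Ne, ZMod.intCast_zmod_eq_zero_iff_dvd]; exact not_dvd_primeCompl (p := ℓ) hB)
  generalize legendreSym ℓ (primeCompl ℓ A) = s at hsA ⊢
  generalize legendreSym ℓ (primeCompl ℓ B) = t at hsB ⊢
  generalize padicValInt ℓ A = m
  generalize padicValInt ℓ B = n
  -- reduce the exponents mod `2`
  have key : ∀ (m n : ℕ) (s t : ℤ), (s = 1 ∨ s = -1) → (t = 1 ∨ t = -1) →
      (-1 : ℤ) ^ (m * n) * s ^ n * t ^ m =
        (-1) ^ ((m : ZMod 2) * (n : ZMod 2) + (n : ZMod 2) * (if s = -1 then 1 else 0) +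
          (m : ZMod 2) * (if t = -1 then 1 else 0)).val := by
    intro m n s t hs ht
    have hm : (m : ZMod 2) = ((m % 2 : ℕ) : ZMod 2) := by rw [ZMod.natCast_mod]
    have hn : (n : ZMod 2) = ((n % 2 : ℕ) : ZMod 2) := by rw [ZMod.natCast_mod]
    have e1 : (-1 : ℤ) ^ (m * n) = (-1) ^ ((m % 2) * (n % 2)) := by
      have hmn : (m * n) % 2 = ((m % 2) * (n % 2)) % 2 := Nat.mul_mod m n 2
      rw [neg_one_pow_eq_pow_mod_two (n := m * n), hmn, ← neg_one_pow_eq_pow_mod_two]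
    have e2 : s ^ n = s ^ (n % 2) := by
      rcases Nat.even_or_odd n with he | ho
      · rw [pow_eq_one_of_even_of_sign hs he, Nat.even_iff.mp he, pow_zero]
      · rw [pow_eq_self_of_odd_of_sign hs ho, Nat.odd_iff.mp ho, pow_one]
    have e3 : t ^ m = t ^ (m % 2) := by
      rcases Nat.even_or_odd m with he | ho
      · rw [pow_eq_one_of_even_of_sign ht he, Nat.even_iff.mp he, pow_zero]
      · rw [pow_eq_self_of_odd_of_sign ht ho, Nat.odd_iff.mp ho, pow_one]
    rw [e1, e2, e3, hm, hn]
    have hm2 : m % 2 < 2 := Nat.mod_lt _ two_pos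
    have hn2 : n % 2 < 2 := Nat.mod_lt _ two_pos
    generalize m % 2 = a at hm2 ⊢
    generalize n % 2 = b at hn2 ⊢
    interval_cases a <;> interval_cases b <;> rcases hs with rfl | rfl <;> rcases ht with rfl | rfl <;> decide
  exact key m n s t hsA hsB

/-- **Signs with even valuations are trivial**: at an odd prime `ℓ`, if `v_ℓ(A)` and `v_ℓ(B)` are even then
`(A, B)_ℓ = 1`. [cite: Serre1973, Ch. III §1.2 Thm. 1] -/
theorem localSignOdd_eq_one_of_even (hℓ2 : ℓ ≠ 2) {A B : ℤ} (hA : A ≠ 0) (hB : B ≠ 0)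
    (heA : Even (padicValInt ℓ A)) (heB : Even (padicValInt ℓ B)) : localSignOdd ℓ A B = 1 := by
  rw [localSignOdd_def]
  have hχ : ZMod.χ₄ (ℓ : ZMod 4) = 1 ∨ ZMod.χ₄ (ℓ : ZMod 4) = -1 := by
    rcases hℓ.out.eq_two_or_odd with h2 | hodd
    · exact absurd h2 hℓ2
    · have h4 : ℓ % 4 = 1 ∨ ℓ % 4 = 3 := by omega
      rcases h4 with h4 | h4
      · exact Or.inl (ZMod.χ₄_nat_one_mod_four h4)
      · exact Or.inr (ZMod.χ₄_nat_three_mod_four h4)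
  have hsA : legendreSym ℓ (primeCompl ℓ A) = 1 ∨ legendreSym ℓ (primeCompl ℓ A) = -1 :=
    legendreSym.eq_one_or_neg_one ℓ (by
      rw [Ne, ZMod.intCast_zmod_eq_zero_iff_dvd]; exact not_dvd_primeCompl (p := ℓ) hA)
  have hsB : legendreSym ℓ (primeCompl ℓ B) = 1 ∨ legendreSym ℓ (primeCompl ℓ B) = -1 :=
    legendreSym.eq_one_or_neg_one ℓ (by
      rw [Ne, ZMod.intCast_zmod_eq_zero_iff_dvd]; exact not_dvd_primeCompl (p := ℓ) hB)
  rw [pow_eq_one_of_even_of_sign hχ (heA.mul_right _), pow_eq_one_of_even_of_sign hsA heB,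
    pow_eq_one_of_even_of_sign hsB heA, one_mul, one_mul]

/-- `localSign ℓ A B = 1` at an odd prime where both valuations are even. [cite: Serre1973, Ch. III §1.2 Thm. 1] -/
theorem localSign_eq_one_of_even (hℓ2 : ℓ ≠ 2) {A B : ℤ} (hA : A ≠ 0) (hB : B ≠ 0)
    (heA : Even (padicValInt ℓ A)) (heB : Even (padicValInt ℓ B)) : localSign ℓ A B = 1 := by
  rw [localSign, if_neg hℓ2]
  exact localSignOdd_eq_one_of_even hℓ2 hA hB heA heB

omit hℓ in
/-- **The sign at infinity in bits**: `(A, B)_∞ = (−1)^{signBit A · signBit B}`. [cite: Serre1973, Ch. III §1.2 Thm. 1] -/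
theorem localSignInfty_eq_neg_one_pow_signBit (A B : ℤ) :
    localSignInfty A B = (-1) ^ (signBit (A : ℚ) * signBit (B : ℚ)).val := by
  unfold localSignInfty signBit
  by_cases hA : A < 0 <;> by_cases hB : B < 0
  · rw [if_pos ⟨hA, hB⟩, if_pos (by exact_mod_cast hA), if_pos (by exact_mod_cast hB)]; decide
  · rw [if_neg (fun h => hB h.2), if_pos (by exact_mod_cast hA), if_neg (by exact_mod_cast hB)]; decide
  · rw [if_neg (fun h => hA h.1), if_neg (by exact_mod_cast hA), if_pos (by exact_mod_cast hB)]; decide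
  · rw [if_neg (fun h => hA h.1), if_neg (by exact_mod_cast hA), if_neg (by exact_mod_cast hB)]; decide

omit hℓ in
/-- Even valuation in bits: `parityBit ℓ A = 0 ↔ v_ℓ(A)` even. [folklore] -/
theorem even_padicValInt_of_parityBit_eq_zero {A : ℤ} (h : parityBit ℓ (A : ℚ) = 0) : Even (padicValInt ℓ A) := by
  rw [parityBit_intCast_eq, ZMod.natCast_eq_zero_iff_even] at h
  exact h

/-- The bits of a rational and of an integral representative of its square class agree. [folklore] -/
theorem bits_eq_of_mul_sq_eq {a c : ℚ} {A : ℤ} (ha : a ≠ 0) (hc : c ≠ 0) (h : a * c ^ 2 = A) :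
    parityBit ℓ a = parityBit ℓ (A : ℚ) ∧ qrBit ℓ a = qrBit ℓ (A : ℚ) ∧ signBit a = signBit (A : ℚ) := by
  refine ⟨?_, ?_, ?_⟩
  · rw [← h, parityBit_mul ha (pow_ne_zero _ hc), sq, parityBit_mul hc hc, CharTwo.add_self_eq_zero, add_zero]
  · rw [← h, qrBit_mul ℓ ha (pow_ne_zero _ hc), qrBit_sq, add_zero]
  · rw [← h, signBit_mul ha (pow_ne_zero _ hc), (signBit_eq_zero_iff (pow_ne_zero _ hc)).mpr (by positivity), add_zero]

end Signs

/-! ## §2 Hilbert reciprocity for the descent form -/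

section Reciprocity

/-- **`∏_v Q_v(A, B) = 1`**: for non-zero integers `A, B, D₁, D₂`, the product over `∞` and the primes dividing
`2 A B D₁ D₂` of the form signs `(A,B)_v (A,D₂)_v (B,D₁)_v` is `1` — three instances of Hilbert reciprocity over `ℚ`
(tree `totalSign_eq_one`: bimultiplicativity, quadratic reciprocity and its supplements).
[cite: Serre1973, Ch. III §2.1 Thm. 3] [cite: KlagsbrunMazurRubin2013, Def. 3.3] -/
theorem prod_localSign_descentForm_eq_one {A B D₁ D₂ : ℤ} (hA : A ≠ 0) (hB : B ≠ 0) (hD₁ : D₁ ≠ 0) (hD₂ : D₂ ≠ 0) :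
    (localSignInfty A B * localSignInfty A D₂ * localSignInfty B D₁) *
      ∏ ℓ ∈ (2 * A * B * D₁ * D₂).natAbs.primeFactors, (localSign ℓ A B * localSign ℓ A D₂ * localSign ℓ B D₁) = 1 := by
  set P := (2 * A * B * D₁ * D₂).natAbs.primeFactors with hP
  set T := P.erase 2 with hT
  have hN : (2 * A * B * D₁ * D₂).natAbs ≠ 0 :=
    Int.natAbs_ne_zero.2 (mul_ne_zero (mul_ne_zero (mul_ne_zero (mul_ne_zero two_ne_zero hA) hB) hD₁) hD₂)
  have hTprime : ∀ q ∈ T, q.Prime ∧ q ≠ 2 := fun q hq =>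
    ⟨Nat.prime_of_mem_primeFactors (Finset.mem_of_mem_erase hq), Finset.ne_of_mem_erase hq⟩
  have hmemT : ∀ x : ℤ, x ∣ 2 * A * B * D₁ * D₂ → ∀ q : ℕ, q.Prime → q ≠ 2 → (q : ℤ) ∣ x → q ∈ T := by
    intro x hx q hq hq2 hqx
    refine Finset.mem_erase.2 ⟨hq2, Nat.mem_primeFactors.2 ⟨hq, ?_, hN⟩⟩
    exact Int.natAbs_dvd_natAbs.2 (hqx.trans hx) |>.trans (by simp)
  have hdA : A ∣ 2 * A * B * D₁ * D₂ := ⟨2 * B * D₁ * D₂, by ring⟩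
  have hdB : B ∣ 2 * A * B * D₁ * D₂ := ⟨2 * A * D₁ * D₂, by ring⟩
  have hdD₁ : D₁ ∣ 2 * A * B * D₁ * D₂ := ⟨2 * A * B * D₂, by ring⟩
  have hdD₂ : D₂ ∣ 2 * A * B * D₁ * D₂ := ⟨2 * A * B * D₁, by ring⟩
  have h1 := totalSign_eq_one T hTprime hA hB (hmemT A hdA) (hmemT B hdB)
  have h2 := totalSign_eq_one T hTprime hA hD₂ (hmemT A hdA) (hmemT D₂ hdD₂)
  have h3 := totalSign_eq_one T hTprime hB hD₁ (hmemT B hdB) (hmemT D₁ hdD₁)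
  unfold totalSign at h1 h2 h3
  have h2P : 2 ∈ P := Nat.mem_primeFactors.2 ⟨Nat.prime_two, by
    simp only [Int.natAbs_mul]
    exact dvd_mul_of_dvd_left (dvd_mul_of_dvd_left (dvd_mul_of_dvd_left (dvd_mul_right _ _) _) _) _, hN⟩
  -- `∏_{ℓ ∈ P} localSign = localSignTwo · ∏_{ℓ ∈ T} localSignOdd`
  have split : ∀ X Y : ℤ, ∏ ℓ ∈ P, localSign ℓ X Y = localSignTwo X Y * ∏ ℓ ∈ T, localSignOdd ℓ X Y := by
    intro X Y
    rw [← Finset.mul_prod_erase P _ h2P]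
    have e2 : localSign 2 X Y = localSignTwo X Y := by simp [localSign]
    rw [e2]
    congr 1
    exact Finset.prod_congr rfl fun ℓ hℓ => by
      have hne : ℓ ≠ 2 := Finset.ne_of_mem_erase hℓ
      simp [localSign, hne]
  rw [Finset.prod_mul_distrib, Finset.prod_mul_distrib, split, split, split]
  calc _ = (localSignInfty A B * localSignTwo A B * ∏ ℓ ∈ T, localSignOdd ℓ A B) *
          (localSignInfty A D₂ * localSignTwo A D₂ * ∏ ℓ ∈ T, localSignOdd ℓ A D₂) *
          (localSignInfty B D₁ * localSignTwo B D₁ * ∏ ℓ ∈ T, localSignOdd ℓ B D₁) := by ring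
    _ = 1 := by rw [h1, h2, h3]; ring

/-- The form sign at a prime not dividing `2 A B D₁ D₂` is `1`. [cite: Serre1973, Ch. III §1.2 Thm. 1] -/
theorem localSign_descentForm_eq_one_of_not_mem {A B D₁ D₂ : ℤ} {ℓ : ℕ} (hℓ : ℓ.Prime)
    (hℓP : ℓ ∉ (2 * A * B * D₁ * D₂).natAbs.primeFactors) (hN : (2 * A * B * D₁ * D₂) ≠ 0) :
    localSign ℓ A B * localSign ℓ A D₂ * localSign ℓ B D₁ = 1 := by
  have hnd : ¬ (ℓ : ℤ) ∣ 2 * A * B * D₁ * D₂ := by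
    intro hd
    apply hℓP
    exact Nat.mem_primeFactors.2 ⟨hℓ, Int.natCast_dvd.mp hd, Int.natAbs_ne_zero.2 hN⟩
  have h1 : ¬ (ℓ : ℤ) ∣ 2 * A * B := fun h => hnd (Dvd.dvd.mul_right (Dvd.dvd.mul_right h D₁) D₂)
  have h2 : ¬ (ℓ : ℤ) ∣ 2 * A * D₂ := fun h => hnd (by
    obtain ⟨k, hk⟩ := h; exact ⟨k * B * D₁, by linear_combination B * D₁ * hk⟩)
  have h3 : ¬ (ℓ : ℤ) ∣ 2 * B * D₁ := fun h => hnd (by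
    obtain ⟨k, hk⟩ := h; exact ⟨k * A * D₂, by linear_combination A * D₂ * hk⟩)
  rw [localSign_eq_one_of_not_dvd hℓ h1, localSign_eq_one_of_not_dvd hℓ h2, localSign_eq_one_of_not_dvd hℓ h3]
  norm_num

end Reciprocity

end Summit.BirchSwinnertonDyer.BirchSwinnertonDyer.Theorems.GenusKolyvaginAtTwo.TorsionCellD0

end
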